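import Summits.PneNP.PneNP.Theorems.ConvexRankGatesCliqueExtLowerBoundHorns
import Summits.PneNP.PneNP.Theorems.ConvexRankGatesCliqueExtLowerBoundStubNarrowAlgebraic
import Summits.PneNP.PneNP.Theorems.ConvexRankGatesCliqueExtLowerBoundStubReferee
import Summits.PneNP.PneNP.Theorems.ConvexRankGatesLinAlgGateBlindKonigIsGRank

/-!
# Gates accepting every coclique-free graph are sandwichable on the referee pair
(sub-class of the leaf `stub_grankCnf` — and of its siblings — line `width-threshold-certificate-sparsity`,
crux `CliqueExtLowerBound`, stmt-PneNP-10682; stub-worker of lead c10 — extract 1/2 of `work/stubs/StubGRankCnf.lean`,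
which has the horn analysis; extract 2/2 `…MatchingGates` applies this to the Tutte / Edmonds matching gates)

On the referee pair (bare `⌈m^{1/4}⌉₊`-cliques vs complements `E ∖ M` of the `(#E/⌊m^{1/8}⌋₊)`-subsets `M` of the
edge slots) every Boolean function of the edge slots that ACCEPTS EVERY GRAPH WITHOUT A COCLIQUE ON `w ≥ c + 19`
VERTICES is blind on the negatives at the sharp threshold: all but `≤ C(m, c+19) / ⌊m^{1/8}⌋₊^{C(c+19,2)} · #N
≤ #N/(8m^{c+1})` negatives have an on-edge inside every `(c+19)`-set of vertices (the `C(c+19,2)` slots inside such a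
set all lie in `M`; a fixed set of `j` slots lies in `M` for a `≤ ⌊m^{1/8}⌋₊^{-j}` fraction of the `M`,
`card_filter_neg_mul_pow_le`; `8 m^{c+1} C(m,c+19) ≤ ⌊m^{1/8}⌋₊^{8(2c+20)+1}` eventually and `8(2c+20)+1 ≤ C(c+19,2)`),
so the constant pair `({∅}, ∅)` does it (`Horns.pair_of_blind`): `pair_of_acceptsCocliqueFree`. Incomparable with
`DiamTwo.pair_of_acceptsDiamTwo` (two disjoint cliques are coclique-free and disconnected; a star has diameter two
and cocliques on `m − 1` vertices). Tools for the members: `exists_wireMatching` (coclique-free ⇒ a matching of `t`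
switched-on wires with distinct endpoints whenever `2t + w ≤ m + 2`, greedy), and two generic-rank bounds for linear
pencils `∑_{v_j=1} X_j K_j` — `rank_symbolicMatrix_le_card` (rank `≤ #Q` if the on-data is supported on the rows `Q`)
and `edmonds_rank_ge` (rank-one data `E_{a j, b j}`: rank `≥ t` on `t` on-wires with distinct tails and distinct
heads, by NUMERIC SPECIALISATION at the sub-matching, `det_submatrix_symbolicMatrix_ne_zero_of_eval` +
`symbolicMatrix_rank_mono`). Formalisation note: `Nat.choose` of a numeral-headed argument in a hypothesis blows up
`whnf` (hence the exponent `8(c+1+(c+19))+1` in `eventually_coclique_numerics`).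
-/

set_option linter.dupNamespace false
open Literature.Computability.Complexity Filter Finset
open Summit.PneNP.PneNP.Theorems.CliqueExtLowerBound.WidthThreshold

noncomputable section
namespace Summit.PneNP.PneNP.Theorems.CliqueExtLowerBound.WidthThreshold.CocliqueFree

open Summit.PneNP.PneNP.Theorems.CliqueExtLowerBound.WidthThreshold.NarrowAlgebraicHelpers
  (card_filter_neg_mul_pow_le cast_le_eps_mul lt_floor_rpow_add_one_pow ceil_rpow_sub_one_pow_lt
    le_ceil_rpow_pow)
open Summit.PneNP.PneNP.Theorems.CliqueExtLowerBound.WidthThreshold.NarrowAlgebraic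
  (card_mul_le_of_subset_biUnion)

/-! ## §1 Almost every negative of the referee pair has no coclique on `c + 19` vertices -/

open Classical in
/-- **Union bound, cocliques.** Among the negatives of the referee pair (complements of the
`(#E/⌊m^{1/8}⌋₊)`-subsets `M` of the edge slots, `m ≥ 1`), those having `w` vertices with NO on-edge
among them number at most `C(m, w) / ⌊m^{1/8}⌋₊^{C(w,2)}` of all (cross-multiplied): such a negative has
the `≥ C(w,2)` edge slots inside one of the `C(m, w)` vertex sets `W` all inside `M`, and a fixed set
`S` of slots lies inside `M` for at most a `⌊m^{1/8}⌋₊^{-#S}` fraction of the `M`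
(`card_filter_neg_mul_pow_le`). Stated with any exponent `j ≤ C(w,2)` (keep `C(w,2)` of a numeral-headed
`w` out of hypotheses: it blows up `whnf`). [folklore] -/
theorem card_negFilter_coclique_mul_le {m : ℕ} (hm : 1 ≤ m) (w j : ℕ) (hj : j ≤ w.choose 2) :
    #((((powersetCard (Fintype.card (EV m) / ⌊(m : ℝ) ^ (1 / 8 : ℝ)⌋₊)
        (univ : Finset (EV m))).image (fun M => fun e => decide (e ∉ M))).filter fun y =>
          ∃ W : Finset (Fin m), #W = w ∧
            ∀ e : EV m, (∀ v ∈ (e : Sym2 (Fin m)), v ∈ W) → y e = false)) *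
        ⌊(m : ℝ) ^ (1 / 8 : ℝ)⌋₊ ^ j ≤
      m.choose w * #(((powersetCard (Fintype.card (EV m) / ⌊(m : ℝ) ^ (1 / 8 : ℝ)⌋₊)
        (univ : Finset (EV m))).image (fun M => fun e => decide (e ∉ M)))) := by
  set D : ℕ := ⌊(m : ℝ) ^ (1 / 8 : ℝ)⌋₊ with hDdef
  set N := ((powersetCard (Fintype.card (EV m) / D) (univ : Finset (EV m))).image
    (fun M => fun e => decide (e ∉ M))) with hNdef
  have hD : 1 ≤ D := by
    rw [hDdef, Nat.one_le_floor_iff]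
    exact Real.one_le_rpow (by exact_mod_cast hm) (by norm_num)
  have htD : Fintype.card (EV m) / D * D ≤ Fintype.card (EV m) := Nat.div_mul_le_self _ _
  -- the clause of a vertex set `W`: the edge slots inside `W`
  set S : Finset (Fin m) → Finset (EV m) := fun W =>
    univ.filter fun e : EV m => ∀ v ∈ (e : Sym2 (Fin m)), v ∈ W with hSdef
  have hcover := card_mul_le_of_subset_biUnion
    (N.filter fun y => ∃ W : Finset (Fin m), #W = w ∧
      ∀ e : EV m, (∀ v ∈ (e : Sym2 (Fin m)), v ∈ W) → y e = false)
    (powersetCard w (univ : Finset (Fin m))) (fun W => N.filter fun y => ¬ SatClause (S W) y)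
    (W := D ^ j) (total := #N) ?_ ?_
  · rwa [card_powersetCard, card_univ, Fintype.card_fin] at hcover
  · intro y hy
    rw [mem_filter] at hy
    obtain ⟨hyN, W, hW, hoff⟩ := hy
    rw [mem_biUnion]
    refine ⟨W, mem_powersetCard.2 ⟨subset_univ _, hW⟩, mem_filter.2 ⟨hyN, ?_⟩⟩
    rintro ⟨e, he, hye⟩
    rw [hSdef, mem_filter] at he
    rw [hoff e he.2] at hye
    exact Bool.false_ne_true hye
  · intro W hW
    rw [mem_powersetCard] at hW
    have hS : j ≤ #(S W) := hj.trans (hW.2 ▸ Referee.choose_two_le_card_edgesIn W)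
    have hmass := card_filter_neg_mul_pow_le hD htD (fun M => fun e => decide (e ∉ M))
      (fun M e => by simp) (S W) (fun y => ¬ SatClause (S W) y) (fun _ h => h)
    calc #(N.filter fun y => ¬ SatClause (S W) y) * D ^ j
        ≤ #(N.filter fun y => ¬ SatClause (S W) y) * D ^ #(S W) :=
          Nat.mul_le_mul_left _ (Nat.pow_le_pow_right hD hS)
      _ ≤ #N := hmass

/-- The exponent bookkeeping: `8 (c + 1 + (c + 19)) + 1 ≤ C(c + 19, 2)`. [folklore] -/
theorem exponent_le_choose (c : ℕ) : 8 * (c + 1 + (c + 19)) + 1 ≤ (c + 19).choose 2 := by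
  rw [Nat.choose_two_right, Nat.le_div_iff_mul_le (by norm_num : 0 < 2)]
  have : c + 19 - 1 = c + 18 := rfl
  rw [this]
  nlinarith [Nat.zero_le (c * c)]

/-- **Numerics.** Eventually `8 m^{c+1} · C(m, c+19) ≤ ⌊m^{1/8}⌋₊^{8(c+1+(c+19))+1}` (and the exponent
is `≤ C(c+19, 2)`, `exponent_le_choose`): with `D = ⌊m^{1/8}⌋₊` one has `m < (D+1)^8 ≤ 256 D^8`, so
`8 m^{c+1} C(m, w) ≤ 8 m^{c+1+w} ≤ 8 · 256^{c+1+w} D^{8(c+1+w)} ≤ D^{8(c+1+w)+1}` once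
`D ≥ 8 · 256^{c+1+w}`. [folklore] -/
theorem eventually_coclique_numerics (c : ℕ) :
    ∀ᶠ m : ℕ in atTop, 8 * m ^ (c + 1) * m.choose (c + 19) ≤
      ⌊(m : ℝ) ^ (1 / 8 : ℝ)⌋₊ ^ (8 * (c + 1 + (c + 19)) + 1) := by
  filter_upwards [eventually_ge_atTop ((8 * 256 ^ (c + 1 + (c + 19))) ^ 8)] with m hm
  set J : ℕ := c + 1 + (c + 19) with hJ
  set D : ℕ := ⌊(m : ℝ) ^ (1 / 8 : ℝ)⌋₊ with hDdef
  have h1 : m < (D + 1) ^ 8 := lt_floor_rpow_add_one_pow m 8 (e := 1 / 8) (by norm_num)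
  have hB1 : 1 ≤ 8 * 256 ^ J := by
    have : 1 ≤ 256 ^ J := Nat.one_le_pow _ _ (by norm_num)
    omega
  have hDB : 8 * 256 ^ J ≤ D := by
    by_contra hlt
    push Not at hlt
    have h2 : (D + 1) ^ 8 ≤ (8 * 256 ^ J) ^ 8 := Nat.pow_le_pow_left (by omega) 8
    omega
  have hD1 : 1 ≤ D := hB1.trans hDB
  have hm256 : m ≤ 256 * D ^ 8 := by
    have h2 : (D + 1) ^ 8 ≤ (2 * D) ^ 8 := Nat.pow_le_pow_left (by omega) 8
    have h3 : (2 * D) ^ 8 = 256 * D ^ 8 := by rw [mul_pow]; norm_num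
    omega
  calc 8 * m ^ (c + 1) * m.choose (c + 19)
      ≤ 8 * m ^ (c + 1) * m ^ (c + 19) := Nat.mul_le_mul_left _ (Nat.choose_le_pow m (c + 19))
    _ = 8 * m ^ J := by rw [hJ]; ring
    _ ≤ 8 * (256 * D ^ 8) ^ J := Nat.mul_le_mul_left _ (Nat.pow_le_pow_left hm256 J)
    _ = 8 * 256 ^ J * D ^ (8 * J) := by rw [mul_pow, ← pow_mul, mul_assoc]
    _ ≤ D * D ^ (8 * J) := Nat.mul_le_mul_right _ hDB
    _ = D ^ (8 * J + 1) := by rw [pow_succ]; ring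

open Classical in
/-- PROPOSED SUB-GOAL (binder-free; a structural sub-class of the leaf `stub_grankCnf` — and of its two
siblings — that is always NEG-BLIND at the sharp threshold). **Every Boolean function of the edge slots
that accepts every graph without a coclique on `w ≥ c + 19` vertices has, on the referee pair, a legal
local pair with both errors `≤ 1/(8 m^{c+1})`** — for all large `m`, every family `P` of positives and
every locality `(r, s)`: all but `≤ C(m, c+19) / ⌊m^{1/8}⌋₊^{C(c+19,2)} · #N ≤ #N / (8 m^{c+1})` negatives
have an on-edge inside every `(c+19)`-set, hence inside every `w`-set (`card_negFilter_coclique_mul_le`,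
`eventually_coclique_numerics`), so such a `g` rejects `≤ #N/(8m^{c+1})` negatives and the constant pair
`({∅}, ∅)` does it (`Horns.pair_of_blind`). Members among the GRANK gates reading the edges: the Tutte and
Edmonds matching gates (`tutteGate_grankCnf`, `edmondsGate_grankCnf`; thresholds `θ` with
`2θ + c + 19 ≤ m + 2`), the generic symmetric "basic 2-matching" gates, and every gate accepting all graphs
with a matching of `(m + 2 - w)/2` edges (`exists_wireMatching`); incomparable with
`DiamTwo.pair_of_acceptsDiamTwo` (two disjoint cliques are coclique-free and disconnected; a star has
diameter two and cocliques of size `m - 1`). [folklore] -/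
theorem pair_of_acceptsCocliqueFree : ∀ c w : ℕ, c + 19 ≤ w → ∀ᶠ m : ℕ in atTop,
    ∀ g : (EV m → Bool) → Bool,
    (∀ y : EV m → Bool, (∀ W : Finset (Fin m), #W = w →
        ∃ e : EV m, (∀ v ∈ (e : Sym2 (Fin m)), v ∈ W) ∧ y e = true) → g y = true) →
    ∀ (P : Finset (EV m → Bool)) (r s : ℕ),
    ∃ dnf cnf : Finset (Finset (EV m)), (∀ R ∈ dnf, #R ≤ r - 1) ∧ (∀ S ∈ cnf, #S ≤ s - 1) ∧
      (∀ x, EvalDNF dnf x → EvalCNF cnf x) ∧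
      (#(P.filter fun x => g x = true ∧ ¬ EvalDNF dnf x) : ℝ) ≤
        (1 / (8 * (m : ℝ) ^ (c + 1))) * #P ∧
      (#((((powersetCard (Fintype.card (EV m) / ⌊(m : ℝ) ^ (1 / 8 : ℝ)⌋₊)
        (univ : Finset (EV m))).image (fun M => fun e => decide (e ∉ M)))).filter
          fun x => EvalCNF cnf x ∧ g x = false) : ℝ) ≤
        (1 / (8 * (m : ℝ) ^ (c + 1))) *
          #(((powersetCard (Fintype.card (EV m) / ⌊(m : ℝ) ^ (1 / 8 : ℝ)⌋₊)
            (univ : Finset (EV m))).image (fun M => fun e => decide (e ∉ M)))) := by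
  intro c w hw
  filter_upwards [eventually_coclique_numerics c, eventually_ge_atTop 1] with m hnum hm g hg P r s
  set D : ℕ := ⌊(m : ℝ) ^ (1 / 8 : ℝ)⌋₊ with hDdef
  set N := ((powersetCard (Fintype.card (EV m) / D) (univ : Finset (EV m))).image
    (fun M => fun e => decide (e ∉ M))) with hNdef
  have hD : 1 ≤ D := by
    rw [hDdef, Nat.one_le_floor_iff]
    exact Real.one_le_rpow (by exact_mod_cast hm) (by norm_num)
  -- a rejected negative has a coclique on `c + 19` vertices
  have hsub : N.filter (fun x => g x = false) ⊆ N.filter fun y =>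
      ∃ W : Finset (Fin m), #W = c + 19 ∧
        ∀ e : EV m, (∀ v ∈ (e : Sym2 (Fin m)), v ∈ W) → y e = false := by
    intro y hy
    rw [mem_filter] at hy ⊢
    refine ⟨hy.1, ?_⟩
    by_contra hno
    push Not at hno
    have hacc : g y = true := by
      refine hg y fun W hW => ?_
      obtain ⟨W', hW'W, hW'⟩ := exists_subset_card_eq (show c + 19 ≤ #W from hW ▸ hw)
      obtain ⟨e, he, hye⟩ := hno W' hW'
      exact ⟨e, fun v hv => hW'W (he v hv), by simpa using hye⟩
    rw [hy.2] at hacc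
    exact Bool.false_ne_true hacc
  have key : #(N.filter fun x => g x = false) * (8 * m ^ (c + 1)) ≤ #N := by
    have hbad := card_negFilter_coclique_mul_le hm (c + 19) (8 * (c + 1 + (c + 19)) + 1)
      (exponent_le_choose c)
    have hDpos : 0 < D ^ (8 * (c + 1 + (c + 19)) + 1) := pow_pos hD _
    refine Nat.le_of_mul_le_mul_right ?_ hDpos
    calc #(N.filter fun x => g x = false) * (8 * m ^ (c + 1)) * D ^ (8 * (c + 1 + (c + 19)) + 1)
        = #(N.filter fun x => g x = false) * D ^ (8 * (c + 1 + (c + 19)) + 1) *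
            (8 * m ^ (c + 1)) := by ring
      _ ≤ #(N.filter fun y => ∃ W : Finset (Fin m), #W = c + 19 ∧
            ∀ e : EV m, (∀ v ∈ (e : Sym2 (Fin m)), v ∈ W) → y e = false) *
            D ^ (8 * (c + 1 + (c + 19)) + 1) * (8 * m ^ (c + 1)) :=
          Nat.mul_le_mul_right _ (Nat.mul_le_mul_right _ (card_le_card hsub))
      _ ≤ m.choose (c + 19) * #N * (8 * m ^ (c + 1)) := Nat.mul_le_mul_right _ hbad
      _ = 8 * m ^ (c + 1) * m.choose (c + 19) * #N := by ring
      _ ≤ D ^ (8 * (c + 1 + (c + 19)) + 1) * #N := Nat.mul_le_mul_right _ hnum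
      _ = #N * D ^ (8 * (c + 1 + (c + 19)) + 1) := by ring
  clear hnum
  exact Horns.pair_of_blind g P _ (by positivity) r s (Or.inr (cast_le_eps_mul hm key))

/-! ## §2 Coclique-free graphs have large matchings (greedy) -/

/-- **Greedy matchings from coclique-freeness, through a wiring.** Let wires `j` read the vertex pairs
`{a j, b j}` (`a j ≠ b j`) and let `v` be a wire vector such that every `w`-set of vertices contains
both ends of some switched-on wire. Then for every `t` with `2t + w ≤ m + 2` there are `t` switched-on
wires whose `2t` endpoints are pairwise distinct (extend a matching of `t` wires by an on-wire inside
the `≥ w` unmatched vertices). [folklore] -/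
theorem exists_wireMatching {m n w : ℕ} (a b : Fin n → Fin m) (hab : ∀ j, a j ≠ b j)
    (v : Fin n → Bool)
    (hv : ∀ W : Finset (Fin m), #W = w → ∃ j, a j ∈ W ∧ b j ∈ W ∧ v j = true) :
    ∀ t : ℕ, 2 * t + w ≤ m + 2 → ∃ J : Fin t → Fin n, (∀ i, v (J i) = true) ∧
      Function.Injective (a ∘ J) ∧ Function.Injective (b ∘ J) ∧ ∀ i i', a (J i) ≠ b (J i') := by
  classical
  intro t
  induction t with
  | zero =>
    intro _
    exact ⟨Fin.elim0, fun i => Fin.elim0 i, fun i => Fin.elim0 i, fun i => Fin.elim0 i,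
      fun i => Fin.elim0 i⟩
  | succ t ih =>
    intro ht
    obtain ⟨J, hJv, hJa, hJb, hJab⟩ := ih (by omega)
    -- the matched vertices `U` and a `w`-set of unmatched ones
    set U : Finset (Fin m) := univ.image (a ∘ J) ∪ univ.image (b ∘ J) with hU
    have hUcard : #U ≤ 2 * t :=
      calc #U ≤ #(univ.image (a ∘ J)) + #(univ.image (b ∘ J)) := card_union_le _ _
        _ ≤ #(univ : Finset (Fin t)) + #(univ : Finset (Fin t)) :=
          add_le_add card_image_le card_image_le
        _ = 2 * t := by rw [card_univ, Fintype.card_fin]; ring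
    have hUc : w ≤ #Uᶜ := by
      rw [card_compl, Fintype.card_fin]
      omega
    obtain ⟨W, hWU, hW⟩ := exists_subset_card_eq hUc
    obtain ⟨j, haj, hbj, hvj⟩ := hv W hW
    have haU : a j ∉ U := mem_compl.1 (hWU haj)
    have hbU : b j ∉ U := mem_compl.1 (hWU hbj)
    have ha_ne_a : ∀ i, a j ≠ a (J i) := fun i h => haU (by
      rw [hU, mem_union]; exact Or.inl (mem_image.2 ⟨i, mem_univ _, h.symm⟩))
    have ha_ne_b : ∀ i, a j ≠ b (J i) := fun i h => haU (by
      rw [hU, mem_union]; exact Or.inr (mem_image.2 ⟨i, mem_univ _, h.symm⟩))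
    have hb_ne_a : ∀ i, b j ≠ a (J i) := fun i h => hbU (by
      rw [hU, mem_union]; exact Or.inl (mem_image.2 ⟨i, mem_univ _, h.symm⟩))
    have hb_ne_b : ∀ i, b j ≠ b (J i) := fun i h => hbU (by
      rw [hU, mem_union]; exact Or.inr (mem_image.2 ⟨i, mem_univ _, h.symm⟩))
    refine ⟨Fin.cons j J, fun i => ?_, ?_, ?_, fun i i' => ?_⟩
    · induction i using Fin.cases with
      | zero => simpa using hvj
      | succ i₀ => simpa using hJv i₀
    · rw [Fin.comp_cons, Fin.cons_injective_iff]
      exact ⟨fun ⟨i, hi⟩ => ha_ne_a i hi.symm, hJa⟩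
    · rw [Fin.comp_cons, Fin.cons_injective_iff]
      exact ⟨fun ⟨i, hi⟩ => hb_ne_b i hi.symm, hJb⟩
    · induction i using Fin.cases with
      | zero =>
        induction i' using Fin.cases with
        | zero => simpa using hab j
        | succ i₀' => simpa using ha_ne_b i₀'
      | succ i₀ =>
        induction i' using Fin.cases with
        | zero => simpa using (hb_ne_a i₀).symm
        | succ i₀' => simpa using hJab i₀ i₀'

/-! ## §3 Generic rank: lower bound by a matching minor, upper bound by the vertex support -/

section GRank

variable {F : Type*} [Field F] {m n : ℕ}

/-- **Support bound.** If every switched-on `K j` vanishes outside the rows indexed by `Q`, then the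
generic rank of `∑_{v_j = 1} X_j K_j` is at most `#Q`: a `(#Q + 1)`-minor either repeats a row or
selects a row outside `Q`, which is zero (`symbolicMatrix_entry_eq_zero`). [folklore] -/
theorem rank_symbolicMatrix_le_card (K : Fin n → Matrix (Fin m) (Fin m) F) (v : Fin n → Bool)
    (Q : Finset (Fin m)) (hK : ∀ j, v j = true → ∀ p q, p ∉ Q → K j p q = 0) :
    (symbolicMatrix (0 : Matrix (Fin m) (Fin m) F) K v).rank ≤ #Q := by
  classical
  refine Literature.LinearAlgebra.Matrix.rank_le_of_det_submatrix_eq_zero _ fun r c => ?_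
  by_cases hr : Function.Injective r
  · obtain ⟨i, hi⟩ : ∃ i, r i ∉ Q := by
      by_contra hall
      push Not at hall
      have h1 : #(univ.image r) = #Q + 1 := by
        rw [card_image_of_injective _ hr, card_univ, Fintype.card_fin]
      have h2 : univ.image r ⊆ Q := fun p hp => by
        obtain ⟨i, -, rfl⟩ := mem_image.1 hp
        exact hall i
      have := card_le_card h2
      omega
    exact Matrix.det_eq_zero_of_row_eq_zero i fun y =>
      symbolicMatrix_entry_eq_zero 0 K v rfl fun j hj => hK j hj _ _ hi
  · obtain ⟨i, i', hii', hne⟩ : ∃ i i', r i = r i' ∧ i ≠ i' := by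
      simpa [Function.Injective] using hr
    exact Matrix.det_zero_of_row_eq hne (funext fun y => by simp [Matrix.submatrix_apply, hii'])

/-- **Edmonds minor.** For the rank-one data `K j = E_{a j, b j}` and `t` switched-on wires `J i` with
pairwise distinct tails `a (J i)` and pairwise distinct heads `b (J i)`, the generic rank of
`∑_{v_j = 1} X_j K_j` is at least `t`: switching on exactly those wires and specialising `X := 1` gives
a matrix whose `(a ∘ J, b ∘ J)`-minor is the identity (`det_submatrix_symbolicMatrix_ne_zero_of_eval`,
`symbolicMatrix_rank_mono`). [folklore] -/
theorem edmonds_rank_ge {t : ℕ} (a b : Fin n → Fin m) (v : Fin n → Bool) (J : Fin t → Fin n)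
    (hJv : ∀ i, v (J i) = true) (hJa : Function.Injective (a ∘ J))
    (hJb : Function.Injective (b ∘ J)) :
    t ≤ (symbolicMatrix (0 : Matrix (Fin m) (Fin m) F)
      (fun j => Matrix.single (a j) (b j) (1 : F)) v).rank := by
  classical
  have hJinj : Function.Injective J := fun i i' h => hJa (by simp [h])
  have haJ : ∀ i i', a (J i) = a (J i') ↔ i = i' := fun i i' =>
    ⟨fun h => hJa h, fun h => h ▸ rfl⟩
  have hbJ : ∀ i i', b (J i) = b (J i') ↔ i = i' := fun i i' =>
    ⟨fun h => hJb h, fun h => h ▸ rfl⟩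
  -- switch on exactly the wires of the matching
  set v' : Fin n → Bool := fun j => decide (j ∈ univ.image J) with hv'
  have hle : v' ≤ v := by
    intro j
    by_cases h : j ∈ univ.image J
    · obtain ⟨i, -, rfl⟩ := mem_image.1 h
      rw [hJv i]
      exact le_top
    · have h0 : v' j = false := by rw [hv']; exact decide_eq_false h
      rw [h0]
      exact Bool.false_le _
  refine le_trans ?_ (symbolicMatrix_rank_mono _ _ hle)
  have hS : (0 : Matrix (Fin m) (Fin m) F) + ∑ j, (if v' j then Matrix.single (a j) (b j) (1 : F)
      else 0) = ∑ i, Matrix.single (a (J i)) (b (J i)) (1 : F) := by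
    rw [zero_add, ← Finset.sum_filter]
    have hfilt : (univ.filter fun j => v' j = true) = univ.image J := by
      ext j
      simp [hv']
    rw [hfilt, sum_image fun x _ y _ h => hJinj h]
  have hnum : (∑ i, Matrix.single (a (J i)) (b (J i)) (1 : F)).submatrix (a ∘ J) (b ∘ J) = 1 := by
    ext i i'
    simp [Matrix.submatrix_apply, Matrix.sum_apply, Matrix.single_apply, Matrix.one_apply, haJ, hbJ,
      ite_and, Finset.sum_ite_eq']
  have hdet : ((((0 : Matrix (Fin m) (Fin m) F) + ∑ j, if v' j then Matrix.single (a j) (b j) (1 : F)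
      else 0).submatrix (a ∘ J) (b ∘ J))).det ≠ 0 := by
    rw [hS, hnum, Matrix.det_one]
    exact one_ne_zero
  have h := Literature.LinearAlgebra.Matrix.card_le_rank_of_det_submatrix_ne_zero _ _ _
    (det_submatrix_symbolicMatrix_ne_zero_of_eval 0 (fun j => Matrix.single (a j) (b j) (1 : F)) v'
      (a ∘ J) (b ∘ J) hdet)
  simpa using h

end GRank

end Summit.PneNP.PneNP.Theorems.CliqueExtLowerBound.WidthThreshold.CocliqueFree

end
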